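import Summits.Schanuel.Schanuel.Theorems.ZilberEacAnalyticGerms
import Mathlib.Algebra.MvPolynomial.Division
import Mathlib.Algebra.MvPolynomial.Nilpotent
import Literature.NumberTheory.EllipticCurves.FormalGroupLaw
import HarnessLib

/-!
# The equimodular class, XXXVIII: rows of a bivariate polynomial — the bridge from the support
# language of the residual theorems to the row language `Q ∈ ℂ[s][t]` of THEOREM EB

HONEST FRAMING.  Cell `pub-schanuel` (Zilber's Exponential-Algebraic Closedness, case ladder;
host summit Schanuel), seat 2, gen 24.  Bookkeeping: for `P ∈ ℂ[x₀, y₀]` (an `MvPolynomial (Fin 2) ℂ`)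
the polynomial `Q = Σ_{v ∈ supp P} t^{v₁}·(P_v s^{v₀}) ∈ ℂ[s][t]` has `P(x, y) = Q(x)(y)`
(**`eval_eq_rowsPP`**) and coefficients `[s^i][t^j]Q = P_{(i,j)}` (**`coeff_coeff_rowsPP`**); its
`t`-degree is the largest `y₀`-degree in the support, its rows have degree at most the largest
`x₀`-degree, and gen 18's "top row" `Σ_{v₀ = N₀} P_v X^{v₁}` is the top row of `Q`
(**`coeff_topRowSum`**).  (The `Fin 2` Finsupp normal form is reused from the tree's
`Literature.NumberTheory.EllipticCurves.finsupp_fin_two_eq`.)  Also: an irreducible `P` with two distinct `y₀`-degrees has a monomial of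
`y₀`-degree `0` (**`exists_support_snd_eq_zero_of_irreducible`**: otherwise `y₀ ∣ P`).  Used in file
XXXIX to restate the residual of Mantova–Masser's question over polynomial graphs after THEOREM EB and
the quadratic theorem.  [folklore]; nothing here is specific to Schanuel's conjecture.
-/

noncomputable section

open Polynomial

set_option linter.dupNamespace false

namespace Summit.Schanuel.Schanuel.Theorems

section Rows

variable (P : MvPolynomial (Fin 2) ℂ)

/-- The rows polynomial `Σ_v t^{v₁} (P_v s^{v₀})`, stated through its defining sum (no new
definition): its coefficients. [folklore] -/
theorem coeff_coeff_rowsPP (i j : ℕ) :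
    ((∑ v ∈ P.support, Polynomial.monomial (v 1) (Polynomial.monomial (v 0) (P.coeff v)) :
        Polynomial (Polynomial ℂ)).coeff j).coeff i =
      P.coeff (Finsupp.single 0 i + Finsupp.single 1 j) := by
  classical
  rw [Polynomial.finsetSum_coeff, Polynomial.finsetSum_coeff]
  simp only [Polynomial.coeff_monomial]
  have key : ∀ v ∈ P.support,
      (if v 1 = j then Polynomial.monomial (v 0) (P.coeff v) else (0 : Polynomial ℂ)).coeff i =
        if v = Finsupp.single 0 i + Finsupp.single 1 j then P.coeff v else 0 := by
    intro v _
    by_cases hv : v = Finsupp.single 0 i + Finsupp.single 1 j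
    · rw [if_pos hv]
      have h0 : v 0 = i := by rw [hv]; simp
      have h1 : v 1 = j := by rw [hv]; simp
      rw [if_pos h1, Polynomial.coeff_monomial, if_pos h0]
    · rw [if_neg hv]
      by_cases hj : v 1 = j
      · rw [if_pos hj, Polynomial.coeff_monomial]
        rw [if_neg]
        intro h0
        exact hv (by rw [Literature.NumberTheory.EllipticCurves.finsupp_fin_two_eq v, h0, hj])
      · rw [if_neg hj, Polynomial.coeff_zero]
  rw [Finset.sum_congr rfl key, Finset.sum_ite_eq']
  split_ifs with h
  · rfl
  · exact (MvPolynomial.notMem_support_iff.1 h).symm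

/-- **Evaluation through the rows**: `P(x, y) = Q(x)(y)`. [folklore] -/
theorem eval_eq_rowsPP (x y : ℂ) :
    MvPolynomial.eval ![x, y] P =
      ((∑ v ∈ P.support, Polynomial.monomial (v 1) (Polynomial.monomial (v 0) (P.coeff v)) :
        Polynomial (Polynomial ℂ)).map (Polynomial.evalRingHom x)).eval y := by
  rw [MvPolynomial.eval_eq', Polynomial.map_sum, Polynomial.eval_finsetSum]
  refine Finset.sum_congr rfl fun v _ => ?_
  rw [Fin.prod_univ_two, Polynomial.map_monomial, Polynomial.eval_monomial, Polynomial.coe_evalRingHom,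
    Polynomial.eval_monomial]
  simp only [Matrix.cons_val_zero, Matrix.cons_val_one]
  ring

/-- The coefficient `[t^j]Q` vanishes beyond the largest `y₀`-degree. [folklore] -/
theorem coeff_rowsPP_eq_zero {r j : ℕ} (hr : ∀ v ∈ P.support, v 1 ≤ r) (hj : r < j) :
    (∑ v ∈ P.support, Polynomial.monomial (v 1) (Polynomial.monomial (v 0) (P.coeff v)) :
        Polynomial (Polynomial ℂ)).coeff j = 0 := by
  ext i
  rw [coeff_coeff_rowsPP, Polynomial.coeff_zero]
  refine MvPolynomial.notMem_support_iff.1 fun h => ?_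
  have := hr _ h
  simp at this
  omega

/-- `deg_t Q = r`, the largest `y₀`-degree in the support. [folklore] -/
theorem natDegree_rowsPP_eq {r : ℕ} (hr : ∀ v ∈ P.support, v 1 ≤ r) (hex : ∃ v ∈ P.support, v 1 = r) :
    (∑ v ∈ P.support, Polynomial.monomial (v 1) (Polynomial.monomial (v 0) (P.coeff v)) :
        Polynomial (Polynomial ℂ)).natDegree = r := by
  refine le_antisymm ?_ ?_
  · rw [Polynomial.natDegree_le_iff_coeff_eq_zero]
    intro j hj
    exact coeff_rowsPP_eq_zero P hr (by exact_mod_cast hj)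
  · obtain ⟨v, hv, hvr⟩ := hex
    refine Polynomial.le_natDegree_of_ne_zero fun h => ?_
    have h2 := congrArg (fun q : Polynomial ℂ => q.coeff (v 0)) h
    simp only [Polynomial.coeff_zero] at h2
    rw [coeff_coeff_rowsPP, ← hvr, ← Literature.NumberTheory.EllipticCurves.finsupp_fin_two_eq v] at h2
    exact (MvPolynomial.mem_support_iff.1 hv) h2

/-- The rows have degree at most the largest `x₀`-degree. [folklore] -/
theorem natDegree_coeff_rowsPP_le {N₀ : ℕ} (hN : ∀ v ∈ P.support, v 0 ≤ N₀) (j : ℕ) :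
    ((∑ v ∈ P.support, Polynomial.monomial (v 1) (Polynomial.monomial (v 0) (P.coeff v)) :
        Polynomial (Polynomial ℂ)).coeff j).natDegree ≤ N₀ := by
  rw [Polynomial.natDegree_le_iff_coeff_eq_zero]
  intro i hi
  rw [coeff_coeff_rowsPP]
  refine MvPolynomial.notMem_support_iff.1 fun h => ?_
  have := hN _ h
  simp at this
  omega

/-- **Gen 18's top-row sum is the top row of `Q`.** [folklore] -/
theorem coeff_topRowSum (N₀ j : ℕ) :
    (∑ v ∈ P.support.filter (fun v : Fin 2 →₀ ℕ => v 0 = N₀),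
        Polynomial.C (P.coeff v) * Polynomial.X ^ (v 1)).coeff j =
      P.coeff (Finsupp.single 0 N₀ + Finsupp.single 1 j) := by
  classical
  rw [Polynomial.finsetSum_coeff, Finset.sum_filter]
  simp only [Polynomial.coeff_C_mul_X_pow]
  have key : ∀ v ∈ P.support,
      (if v 0 = N₀ then (if j = v 1 then P.coeff v else 0) else 0) =
        if v = Finsupp.single 0 N₀ + Finsupp.single 1 j then P.coeff v else 0 := by
    intro v _
    by_cases hv : v = Finsupp.single 0 N₀ + Finsupp.single 1 j
    · rw [if_pos hv]
      have h0 : v 0 = N₀ := by rw [hv]; simp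
      have h1 : v 1 = j := by rw [hv]; simp
      rw [if_pos h0, if_pos h1.symm]
    · rw [if_neg hv]
      by_cases h0 : v 0 = N₀
      · rw [if_pos h0, if_neg]
        intro h1
        exact hv (by rw [Literature.NumberTheory.EllipticCurves.finsupp_fin_two_eq v, h0, h1])
      · rw [if_neg h0]
  rw [Finset.sum_congr rfl key, Finset.sum_ite_eq']
  split_ifs with h
  · rfl
  · exact (MvPolynomial.notMem_support_iff.1 h).symm

/-- The top-row sum and the top row of `Q` have the same coefficients. [folklore] -/
theorem coeff_topRowSum_eq_coeff_coeff_rowsPP (N₀ j : ℕ) :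
    (∑ v ∈ P.support.filter (fun v : Fin 2 →₀ ℕ => v 0 = N₀),
        Polynomial.C (P.coeff v) * Polynomial.X ^ (v 1)).coeff j =
      ((∑ v ∈ P.support, Polynomial.monomial (v 1) (Polynomial.monomial (v 0) (P.coeff v)) :
        Polynomial (Polynomial ℂ)).coeff j).coeff N₀ := by
  rw [coeff_topRowSum, coeff_coeff_rowsPP]

/-- The `j`-th row sum `Σ_{v₁ = j} P_v X^{v₀}` has coefficients `P_{(i,j)}`. [folklore] -/
theorem coeff_rowSum (j i : ℕ) :
    (∑ v ∈ P.support.filter (fun v : Fin 2 →₀ ℕ => v 1 = j),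
        Polynomial.C (P.coeff v) * Polynomial.X ^ (v 0)).coeff i =
      P.coeff (Finsupp.single 0 i + Finsupp.single 1 j) := by
  classical
  rw [Polynomial.finsetSum_coeff, Finset.sum_filter]
  simp only [Polynomial.coeff_C_mul_X_pow]
  have key : ∀ v ∈ P.support,
      (if v 1 = j then (if i = v 0 then P.coeff v else 0) else 0) =
        if v = Finsupp.single 0 i + Finsupp.single 1 j then P.coeff v else 0 := by
    intro v _
    by_cases hv : v = Finsupp.single 0 i + Finsupp.single 1 j
    · rw [if_pos hv]
      have h0 : v 0 = i := by rw [hv]; simp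
      have h1 : v 1 = j := by rw [hv]; simp
      rw [if_pos h1, if_pos h0.symm]
    · rw [if_neg hv]
      by_cases h1 : v 1 = j
      · rw [if_pos h1, if_neg]
        intro h0
        exact hv (by rw [Literature.NumberTheory.EllipticCurves.finsupp_fin_two_eq v, ← h0, h1])
      · rw [if_neg h1]
  rw [Finset.sum_congr rfl key, Finset.sum_ite_eq']
  split_ifs with h
  · rfl
  · exact (MvPolynomial.notMem_support_iff.1 h).symm

/-- **The row sums are the coefficients of `Q`.** [folklore] -/
theorem rowSum_eq_coeff_rowsPP (j : ℕ) :
    (∑ v ∈ P.support.filter (fun v : Fin 2 →₀ ℕ => v 1 = j),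
        Polynomial.C (P.coeff v) * Polynomial.X ^ (v 0)) =
      (∑ v ∈ P.support, Polynomial.monomial (v 1) (Polynomial.monomial (v 0) (P.coeff v)) :
        Polynomial (Polynomial ℂ)).coeff j := by
  ext i
  rw [coeff_rowSum, coeff_coeff_rowsPP]

/-- **An irreducible `P ∈ ℂ[x₀, y₀]` with two distinct `y₀`-degrees has a monomial free of `y₀`.**
(Otherwise `y₀ ∣ P`, and `P = unit · y₀` has a single `y₀`-degree.) [folklore] -/
theorem exists_support_snd_eq_zero_of_irreducible (hirr : Irreducible P)
    (h2 : ∃ v ∈ P.support, ∃ v' ∈ P.support, v 1 ≠ v' 1) : ∃ u ∈ P.support, u 1 = 0 := by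
  classical
  by_contra hnone
  push Not at hnone
  -- `y₀ ∣ P`
  have hdvd : (MvPolynomial.X 1 : MvPolynomial (Fin 2) ℂ) ∣ P := by
    rw [MvPolynomial.X_dvd_iff_modMonomial_eq_zero]
    ext m
    rw [MvPolynomial.coeff_zero]
    by_cases hm : Finsupp.single (1 : Fin 2) 1 ≤ m
    · exact MvPolynomial.coeff_modMonomial_of_le _ hm
    · rw [MvPolynomial.coeff_modMonomial_of_not_le _ hm]
      refine MvPolynomial.notMem_support_iff.1 fun hmem => hm ?_
      rw [Finsupp.single_le_iff]
      exact Nat.one_le_iff_ne_zero.2 (hnone m hmem)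
  obtain ⟨G, hG⟩ := hdvd
  rcases hirr.isUnit_or_isUnit hG with hu | hu
  · have h := (hu.map (MvPolynomial.eval (0 : Fin 2 → ℂ))).ne_zero
    exact h (by simp)
  · obtain ⟨r, -, hGr⟩ := MvPolynomial.isUnit_iff_eq_C_of_isReduced.1 hu
    -- `P = r · y₀`: every monomial has `y₀`-degree `1`
    have hsupp : ∀ v ∈ P.support, v 1 = 1 := by
      intro v hv
      rw [hG, hGr, MvPolynomial.mem_support_iff, mul_comm, MvPolynomial.coeff_C_mul,
        MvPolynomial.coeff_X] at hv
      by_cases h : Finsupp.single (1 : Fin 2) 1 = v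
      · rw [← h]; simp
      · rw [if_neg h, mul_zero] at hv; exact absurd rfl hv
    obtain ⟨v, hv, v', hv', hne⟩ := h2
    exact hne (by rw [hsupp v hv, hsupp v' hv'])

end Rows

end Summit.Schanuel.Schanuel.Theorems
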